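import Literature.Geometry.Lorentzian.ApproximateKerrConfiguration
import Literature.Geometry.Lorentzian.NearKerrLeaf
import HarnessLib

/-!
# Adiabatic tracking: a vacuum Cauchy development followed, window by window, by chains of
# `ε`-approximate `N`-Kerr configurations with free parameters

One interface definition, `VacuumCauchyDevelopment.IsAdiabaticallyTracked`, consumed by the route
`Summits/FinalStateConjecture/FinalStateConjecture/Theses/RenormalisedDrift.lean` of the final
state conjecture, where it is the *seam* "the development `𝒟` is ADIABATICALLY TRACKED at
accuracy `(ε, L, R₀)` with complexity `(N, m₀, χ)`" shared — as one and the same inlined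
`∃`-block — by the three items `DriftCapture` (stmt-FinalStateConjecture-10853, hypothesis
position: "tracked at ONE accuracy ⇒ settles down"), `AdiabaticTracking` (-10854, conclusion
position: "generically tracked at EVERY accuracy") and `SingleHoleDriftCapture` (-10856, the
`N = 1` instance of `DriftCapture`). Naming the block lets the three items, and their foreseen
layer-2 children (drift-uniform linear theory, renormalised bootstrap, receding assembly), be
restated over one predicate.

## The notion (informal)

Fix a vacuum Cauchy development `𝒟 = (M, g, τ, ι, ν)` of data on the `3`-manifold `X`
(`VacuumCauchyDevelopment`, `CauchyDevelopment.lean`), a number of holes `N`, a mass floor `m₀`,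
a spin bound `χ`, an accuracy `ε : ℝ≥0∞`, a window length `L` and a radius floor `R₀`. Then
`𝒟.IsAdiabaticallyTracked N m₀ χ ε L R₀` says: there are near-zone radii `R : ℕ → ℝ`, a region
`O ⊆ M` and a chain `n ↦ cₙ` of `ε`-approximate Kerr configurations of `O` in `C²` on the
chart-time window `[0, L]` OF THEIR OWN CHARTS with near-zone radius `Rₙ`
(`cₙ : ApproximateKerrConfiguration 𝒟.toSpacetime O 2 ε 0 L (R n)`,
`ApproximateKerrConfiguration.lean`), such that

1. (radii) `R₀ ≤ Rₙ` for all `n`, and `Rₙ → ∞`;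
2. (complexity) every `cₙ` has exactly `N` holes, with masses `m₀ ≤ Mᵢ ≤ m₀⁻¹` and spins
   `|aᵢ| ≤ χ Mᵢ`;
3. (chaining) the certified slab of `cₙ₊₁` at its initial chart time `0` lies in the certified
   window image of `cₙ` (`ApproximateKerrConfiguration.certifiedSlab`, `.windowImage`);
4. (exhaustion) for every compact `K ⊆ M`, the window images of all but finitely many `cₙ` are
   disjoint from `J⁻(K)` — the windows leave every compact past;
5. (pinning) `O` is the self-determined exterior `J⁺(ι X) ∩ I⁻(⋃ₙ window images)`
   (`CauchyDevelopment.exteriorOf`, `NearKerrLeaf.lean`);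
6. (covering) `O ⊆ J⁻(certified slab of c₀ at time 0) ∪ ⋃ₙ window images`.

THE KERR PARAMETERS, MOTIONS AND CHARTS OF DIFFERENT WINDOWS ARE DELIBERATELY UNRELATED: only
`N`, the bounds `m₀`, `χ` and the chaining clause tie consecutive windows, so cumulative `O(1)`
migration of `(Mᵢ, aᵢ)` along the chain is allowed (route header: "a hole doubling its mass under
weak persistent infall is a tracked development"). This is orbital closeness, window by window,
to the MODULI SPACE of sub-extremal `N`-Kerr configurations — in the terminology of Klainerman,
C. R. Mécanique 353 (2025), §2.3 (p. 559): "orbital stability, according to which small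
perturbations of `φ₀` lead to solutions `φ` which remain close to `φ₀` for all time, and asymptotic
stability (AS) according to which the perturbed solutions converge … a third notion, called
asymptotic orbital stability (AOS), to describe the fact that the perturbed solutions may converge
to a different stationary solution. This happens if `φ₀` belongs to a multiparameter smooth family
of stationary solutions" — for the final-state picture of §1.1.1 (pp. 556–557: "solutions which
behave, in the large, like a finite number of Kerr black holes plus a radiative decaying term"),
in the consequence-form `Cᵏ`-deviation gauge of DHRT arXiv:2104.08222, §1 used throughout
`KerrConvergence.lean` / `ApproximateKerrConfiguration.lean`. **No printed formulation of the
predicate exists**: it is posited by the route (planner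
`planner-plancard-FinalStateConjecture-FinalSt-bc34e3d5-0`, 2026-08-15) and recorded here so
that the three items restate readably; nothing is asserted about it.

## Verbatim discipline (why the body looks the way it does)

The body of `IsAdiabaticallyTracked` is, token for token, the parenthesised `∃`-block occurring
three times in the route file (rev 0; in `SingleHoleDriftCapture` with the literal `1` for `N`),
with ONE change forced by the layering rule "`Literature` never imports `Summits`"
(CONVENTIONS §2): the route's `Summit.FinalStateConjecture.exteriorOf 𝒟.toCauchyDevelopment U`
is written `𝒟.toCauchyDevelopment.exteriorOf U` (`CauchyDevelopment.exteriorOf` of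
`NearKerrLeaf.lean`), whose body `J⁺(ι X) ∩ I⁻(U)` is verbatim that of the summit-side auxiliary;
both unfold by `rfl` to the same term. Hence the items restated over the predicate —
`… → 𝒟.IsAdiabaticallyTracked N m₀ χ ε L R₀ → …` in `DriftCapture`,
`… → 𝒟.IsAdiabaticallyTracked N m₀ χ ε L R₀` in `AdiabaticTracking`,
`… → 𝒟.IsAdiabaticallyTracked 1 m₀ χ ε L R₀ → …` in `SingleHoleDriftCapture` — are
DEFINITIONALLY equal to the filed ones (`Iff.rfl`, checked in the literature-prover's scratch file
against the route file at rev 0, which Literature cannot import). As filed: `k = 2` and the window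
start time `0` are fixed, not parameters (each window is read in its own charts, so the start time
is a normalisation); `ε : ℝ≥0∞` is the codomain of `deviationCk` (`ε = ∞`: vacuous closeness); no
sign conditions on `m₀`, `χ`, `L`, `R₀` are built in (the items supply `0 < m₀`, `0 ≤ χ < 1`,
`0 < L`, `0 < ε`). Nothing vacuum-specific is used by the body; the carrier is
`VacuumCauchyDevelopment` because that is the requested signature and the only consumer.

## API

`isAdiabaticallyTracked_iff` (unfolding, `Iff.rfl`); `IsAdiabaticallyTracked.mono` (monotone in
`ε`, via `ApproximateKerrConfiguration.mono`, with the `rfl` lemmas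
`ApproximateKerrConfiguration.mass_mono` / `spin_mono` / `certifiedSlab_mono` recorded here next
to the tree's `mono_N` / `windowImage_mono`); `IsAdiabaticallyTracked.anti` (antitone in `R₀`);
`IsAdiabaticallyTracked.anti_mass` (antitone in the mass floor `m₀ ∈ (0, ∞)`);
`IsAdiabaticallyTracked.mono_spin` (monotone in the spin bound `χ`, masses being positive);
`IsAdiabaticallyTracked.exists_configuration` / `exists_exterior` (bookkeeping consequences). The single-hole
seam of `SingleHoleDriftCapture` is `𝒟.IsAdiabaticallyTracked 1 m₀ χ ε L R₀` (no separate name).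

## Not here

Restatements of the three items (they live under `Summits/`); any relation to
`FinalStateDecomposition`, `OrbitsMultiKerr` or `IsNearKerrLeaf` (statements with analytic /
causal-geometric content, left to the routes); an `N = 0` (Minkowski) sanity instance (no vacuum
Cauchy development is constructed in the tree).

## Mathlib

No Lorentzian geometry, Kerr family or causal structure in Mathlib; used are `Set` algebra,
`Filter.Tendsto … atTop atTop`, `IsCompact`, `Disjoint`, `ℝ≥0∞`, `inv_anti₀`,
`mul_le_mul_of_nonneg_right`. `lean search IsAdiabaticallyTracked`: no declaration in Mathlib or
the tree (2026-08-15).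

## References

* S. Klainerman, *The black hole stability problem*, C. R. Mécanique 353 (2025) 555–581,
  §1.1.1 (pp. 556–557), §2.3 (p. 559).
* M. Dafermos, J. Luk, *The interior of dynamical vacuum black holes I*, arXiv:1710.01722, §1.2.1
  (p. 8) and Conjecture 1 (the exterior region `J⁻(𝓘⁺)`).
* M. Dafermos, G. Holzegel, I. Rodnianski, M. Taylor, arXiv:2104.08222, §1 (the `Cᵏ`-deviation,
  "remains close" gauge; spacetime slabs).
-/

noncomputable section

open Set TopologicalSpace Filter Topology
open scoped Manifold ContDiff Topology ENNReal

universe u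

namespace Literature.Geometry.Lorentzian

/-! ### `rfl` lemmas for `ApproximateKerrConfiguration.mono` -/

namespace ApproximateKerrConfiguration

variable {𝓢 : Spacetime.{u} 4} {O : Set 𝓢.carrier} {k : ℕ} {ε ε' : ℝ≥0∞} {τ L R : ℝ}

/-- `mono` keeps the masses. [folklore] -/
@[simp]
theorem mass_mono (c : ApproximateKerrConfiguration 𝓢 O k ε τ L R) (h : ε ≤ ε') :
    (c.mono h).mass = c.mass := rfl

/-- `mono` keeps the spins. [folklore] -/
@[simp]
theorem spin_mono (c : ApproximateKerrConfiguration 𝓢 O k ε τ L R) (h : ε ≤ ε') :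
    (c.mono h).spin = c.spin := rfl

/-- `mono` keeps the certified slabs. [folklore] -/
@[simp]
theorem certifiedSlab_mono (c : ApproximateKerrConfiguration 𝓢 O k ε τ L R) (h : ε ≤ ε')
    (σ : ℝ) : (c.mono h).certifiedSlab σ = c.certifiedSlab σ := rfl

end ApproximateKerrConfiguration

/-! ### The predicate -/

namespace VacuumCauchyDevelopment

variable {X : Type u} [TopologicalSpace X] [ChartedSpace E3 X] [IsManifold (𝓡 3) ∞ X]
  [ConnectedSpace X] {D : InitialDataSet (𝓡 3) X}

/-- **`𝒟` is adiabatically tracked at accuracy `(ε, L, R₀)` with complexity `(N, m₀, χ)`** (the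
seam of route `RenormalisedDrift` of the final state conjecture, verbatim its inlined `∃`-block
with the summit-side `exteriorOf` written as `CauchyDevelopment.exteriorOf`; module docstring):
there are near-zone radii `Rₙ ≥ R₀` with `Rₙ → ∞`, a region `O`, and a chain `n ↦ cₙ` of
`ε`-approximate Kerr configurations of `O` in `C²` on the chart-time windows `[0, L]` of their own
charts with near-zone radius `Rₙ` (`ApproximateKerrConfiguration 𝒟.toSpacetime O 2 ε 0 L (R n)`),
each with exactly `N` holes of masses `m₀ ≤ Mᵢ ≤ m₀⁻¹` and spins `|aᵢ| ≤ χ Mᵢ`, CHAINED (the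
certified slab of `cₙ₊₁` at chart time `0` lies in the certified window image of `cₙ`),
EXHAUSTING (for every compact `K` the window images are eventually disjoint from `J⁻(K)`), with
`O` PINNED as the self-determined exterior `J⁺(ι X) ∩ I⁻(⋃ₙ window images)` and COVERED by
`J⁻(certified slab of c₀ at time 0) ∪ ⋃ₙ window images`. The Kerr parameters, motions and charts
of different windows are unrelated (cumulative `O(1)` migration allowed). Window-by-window
orbital closeness to the moduli space of sub-extremal `N`-Kerr configurations, in the sense of
the orbital / asymptotic-orbital stability dichotomy of Klainerman, C. R. Mécanique 353 (2025),
§2.3, for the final-state picture of §1.1.1; no printed formulation of the predicate itself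
exists (route-posited). The single-hole seam is `𝒟.IsAdiabaticallyTracked 1 m₀ χ ε L R₀`.
[cite: Klainerman2025, §2.3 (p. 559) and §1.1.1 (pp. 556–557)] -/
def IsAdiabaticallyTracked (𝒟 : VacuumCauchyDevelopment D) (N : ℕ) (m₀ χ : ℝ) (ε : ℝ≥0∞)
    (L R₀ : ℝ) : Prop :=
  ∃ (R : ℕ → ℝ) (O : Set 𝒟.carrier)
    (c : ∀ n : ℕ, ApproximateKerrConfiguration 𝒟.toSpacetime O 2 ε 0 L (R n)),
    -- (1) radii: floor `R₀`, and `Rₙ → ∞`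
    (∀ n, R₀ ≤ R n) ∧ Tendsto R atTop atTop ∧
    -- (2) complexity: `N` holes, masses in `[m₀, m₀⁻¹]`, spins `|aᵢ| ≤ χ Mᵢ`
    (∀ n, (c n).N = N) ∧
    (∀ n (i : Fin (c n).N), m₀ ≤ (c n).mass i ∧ (c n).mass i ≤ m₀⁻¹ ∧
      |(c n).spin i| ≤ χ * (c n).mass i) ∧
    -- (3) chaining: the start slab of window `n + 1` lies in the certified image of window `n`
    (∀ n, (c (n + 1)).certifiedSlab 0 ⊆ (c n).windowImage) ∧
    -- (4) exhaustion: the windows eventually leave the causal past of every compact set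
    (∀ K : Set 𝒟.carrier, IsCompact K → ∃ n₀ : ℕ, ∀ n, n₀ ≤ n →
      Disjoint (c n).windowImage (𝒟.metric.causalPast 𝒟.timeOrientation K)) ∧
    -- (5) pinning: `O = J⁺(ι X) ∩ I⁻(⋃ₙ window images)`
    O = 𝒟.toCauchyDevelopment.exteriorOf (⋃ n, (c n).windowImage) ∧
    -- (6) covering: `O ⊆ J⁻(first certified slab) ∪ ⋃ₙ window images`
    O ⊆ 𝒟.metric.causalPast 𝒟.timeOrientation ((c 0).certifiedSlab 0) ∪ ⋃ n, (c n).windowImage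

/-- Unfolding lemma for `IsAdiabaticallyTracked` (the clause list of the module docstring, with
the exterior region written as `CauchyDevelopment.exteriorOf`), by `Iff.rfl`.
[cite: Klainerman2025, §2.3 (p. 559)] -/
theorem isAdiabaticallyTracked_iff (𝒟 : VacuumCauchyDevelopment D) (N : ℕ) (m₀ χ : ℝ)
    (ε : ℝ≥0∞) (L R₀ : ℝ) :
    𝒟.IsAdiabaticallyTracked N m₀ χ ε L R₀ ↔
      ∃ (R : ℕ → ℝ) (O : Set 𝒟.carrier)
        (c : ∀ n : ℕ, ApproximateKerrConfiguration 𝒟.toSpacetime O 2 ε 0 L (R n)),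
        (∀ n, R₀ ≤ R n) ∧ Tendsto R atTop atTop ∧ (∀ n, (c n).N = N) ∧
        (∀ n (i : Fin (c n).N), m₀ ≤ (c n).mass i ∧ (c n).mass i ≤ m₀⁻¹ ∧
          |(c n).spin i| ≤ χ * (c n).mass i) ∧
        (∀ n, (c (n + 1)).certifiedSlab 0 ⊆ (c n).windowImage) ∧
        (∀ K : Set 𝒟.carrier, IsCompact K → ∃ n₀ : ℕ, ∀ n, n₀ ≤ n →
          Disjoint (c n).windowImage (𝒟.metric.causalPast 𝒟.timeOrientation K)) ∧
        O = 𝒟.toCauchyDevelopment.exteriorOf (⋃ n, (c n).windowImage) ∧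
        O ⊆ 𝒟.metric.causalPast 𝒟.timeOrientation ((c 0).certifiedSlab 0) ∪
          ⋃ n, (c n).windowImage :=
  Iff.rfl

namespace IsAdiabaticallyTracked

variable {𝒟 : VacuumCauchyDevelopment D} {N : ℕ} {m₀ m₀' χ χ' : ℝ} {ε ε' : ℝ≥0∞}
  {L R₀ R₀' : ℝ}

/-- **Monotonicity in `ε` (up).** Tracking at accuracy `ε` implies tracking at every coarser
accuracy `ε' ≥ ε`, with the same radii, region and chain (each configuration is relaxed by
`ApproximateKerrConfiguration.mono`, which keeps all data). DHRT arXiv:2104.08222, §1 ("remains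
close" is an upper bound). [cite: arXiv210408222, §1] -/
theorem mono (h : 𝒟.IsAdiabaticallyTracked N m₀ χ ε L R₀) (hε : ε ≤ ε') :
    𝒟.IsAdiabaticallyTracked N m₀ χ ε' L R₀ := by
  obtain ⟨R, O, c, hR, hRt, hN, hM, hch, hex, hO, hcov⟩ := h
  exact ⟨R, O, fun n ↦ (c n).mono hε, hR, hRt, hN, hM, hch, hex, hO, hcov⟩

/-- **Antitonicity in `R₀`.** Tracking with radius floor `R₀` implies tracking with every smaller
floor `R₀' ≤ R₀`, with the same data. [folklore] -/
theorem anti (h : 𝒟.IsAdiabaticallyTracked N m₀ χ ε L R₀) (hR₀ : R₀' ≤ R₀) :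
    𝒟.IsAdiabaticallyTracked N m₀ χ ε L R₀' := by
  obtain ⟨R, O, c, hR, hrest⟩ := h
  exact ⟨R, O, c, fun n ↦ hR₀.trans (hR n), hrest⟩

/-- **Antitonicity in the mass floor.** Tracking with masses in `[m₀, m₀⁻¹]` implies tracking with
masses in the larger interval `[m₀', m₀'⁻¹]` for `0 < m₀' ≤ m₀` (`inv_anti₀`), with the same data.
[folklore] -/
theorem anti_mass (h : 𝒟.IsAdiabaticallyTracked N m₀ χ ε L R₀) (hm₀' : 0 < m₀')
    (hle : m₀' ≤ m₀) : 𝒟.IsAdiabaticallyTracked N m₀' χ ε L R₀ := by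
  obtain ⟨R, O, c, hR, hRt, hN, hM, hrest⟩ := h
  refine ⟨R, O, c, hR, hRt, hN, fun n i ↦ ?_, hrest⟩
  obtain ⟨h₁, h₂, h₃⟩ := hM n i
  exact ⟨hle.trans h₁, h₂.trans (inv_anti₀ hm₀' hle), h₃⟩

/-- **Monotonicity in the spin bound.** Tracking with `|aᵢ| ≤ χ Mᵢ` implies tracking with
`|aᵢ| ≤ χ' Mᵢ` for `χ ≤ χ'`, with the same data (the masses of a configuration are positive,
`ApproximateKerrConfiguration.mass_pos`). [folklore] -/
theorem mono_spin (h : 𝒟.IsAdiabaticallyTracked N m₀ χ ε L R₀) (hχ : χ ≤ χ') :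
    𝒟.IsAdiabaticallyTracked N m₀ χ' ε L R₀ := by
  obtain ⟨R, O, c, hR, hRt, hN, hM, hrest⟩ := h
  refine ⟨R, O, c, hR, hRt, hN, fun n i ↦ ?_, hrest⟩
  obtain ⟨h₁, h₂, h₃⟩ := hM n i
  exact ⟨h₁, h₂, h₃.trans (mul_le_mul_of_nonneg_right hχ ((c n).mass_pos i).le)⟩

/-- A tracked development carries, for every `n`, an `ε`-approximate configuration with exactly
`N` holes on a window of chart-length `L` with near-zone radius at least `R₀` (bookkeeping: the
chain evaluated at `n`). [folklore] -/
theorem exists_configuration (h : 𝒟.IsAdiabaticallyTracked N m₀ χ ε L R₀) (n : ℕ) :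
    ∃ (R : ℝ) (O : Set 𝒟.carrier) (c : ApproximateKerrConfiguration 𝒟.toSpacetime O 2 ε 0 L R),
      R₀ ≤ R ∧ c.N = N := by
  obtain ⟨R, O, c, hR, -, hN, -⟩ := h
  exact ⟨R n, O, c n, hR n, hN n⟩

/-- The tracked region `O` is the exterior region `J⁺(ι X) ∩ I⁻(U)` of a set `U ⊆ O` (the union of
the window images, which lie in `O` by `ApproximateKerrConfiguration.windowImage_subset`) and is
covered by the causal past of one set (the first certified slab) together with `U` (pinning and
covering clauses). [folklore] -/
theorem exists_exterior (h : 𝒟.IsAdiabaticallyTracked N m₀ χ ε L R₀) :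
    ∃ (O U S : Set 𝒟.carrier), O = 𝒟.toCauchyDevelopment.exteriorOf U ∧ U ⊆ O ∧
      O ⊆ 𝒟.metric.causalPast 𝒟.timeOrientation S ∪ U := by
  obtain ⟨R, O, c, -, -, -, -, -, -, hO, hcov⟩ := h
  exact ⟨O, ⋃ n, (c n).windowImage, (c 0).certifiedSlab 0, hO,
    iUnion_subset fun n ↦ (c n).windowImage_subset, hcov⟩

end IsAdiabaticallyTracked

end VacuumCauchyDevelopment

end Literature.Geometry.Lorentzian

end
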